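import Summits.BirchSwinnertonDyer.BirchSwinnertonDyer.Theorems.PrintCf2SplitBadTwoFramePinningDeuring
import Summits.BirchSwinnertonDyer.BirchSwinnertonDyer.Theorems.PrintCf2RubinValueTwoGoodTwistDictTypePin
import Literature.NumberTheory.EllipticCurves.QuadraticTwistProofs
import Literature.NumberTheory.EllipticCurves.NoEverywhereGoodReductionRat
import HarnessLib

/-!
# Route C `PrintCf2RubinValueTwo`, crux `GoodTwistDictionaryAtTwo` (stmt-BirchSwinnertonDyer-23295), PART 2 / F2B:
# FROBENIUS COMPARISON of the pinned characters of two `ℚ`-isomorphic-up-to-twist members —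
# `ψ_{W′}(ϖ_w) = (ε/p)·ψ_W(ϖ_w)` at split primes, `ψ_{W′}(ϖ_w) = ψ_W(ϖ_w)` at inert ones

Cell `bsd-print-cf2`, width seat `bsd-line-cf2c-w2` g9 (prover-bsd-line-cf2c-w2-g9-0); Theses-free helper
`--supports stmt-BirchSwinnertonDyer-23295`. THEOREMS ONLY (no `def`, no named fact, no `sorry`); CONDITIONAL (displayed binder)
on the print `Deuring_exists_heckeCharacter_of_maximalCM` (conjunct of 23295's hypothesis `…_withGenerators`, also a kernel theorem of the
BED lane); nothing about BSD is asserted; no summit statement is proved by this seat; BSD is not proved by any of this.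

SETTING (the (DICT) supply, PART 2 PLAN on HOME STATUS): a frame field `K` (imaginary quadratic, two places `v ≠ v̄` above `2`, `c ≠ 1`),
a curve `W` with `C • W = cm7^{(d)}` and a globally minimal `W′` with `C″ • W′ = cm7^{(m)}` which is a `ℚ`-model of the quadratic twist
`W^{(ε)}` (`ε` square-free), and their type-`(1,0)` characters `ψ`, `ψ′` pinned by `L(ψ, s) = L(W, s)`, `L(ψ′, s) = L(W′, s)`.
At a rational prime `p ∤ 2ε` of good reduction for both and a place `w ∣ p`:

* `valueAtUniformizer_pow_ne_pow_smul` — F2A's root-of-unity exclusion for TWO characters: `ψ₂(ϖ_{c•w})^M ≠ ψ₁(ϖ_w)^M` (`M ≥ 1`,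
  `c • w ≠ w`, both of type `(1,0)`).
* ★ `valueAtUniformizer_twist_eq_of_smul_ne` — **split `w` (`c • w ≠ w`): `ψ′(ϖ_w) = (ε/p) · ψ(ϖ_w)`**. Deuring's clause (iv)
  (`FramePinning.frame_eq_deuring`) gives `ψ(ϖ_w) + ψ(ϖ_{cw}) = a_p(W)`, `ψ(ϖ_w)ψ(ϖ_{cw}) = p` and the same for `ψ′` with
  `a_p(W′) = (ε/p) a_p(W)` (`frobeniusTrace_quadraticTwist_holds`); hence `(ψ′(ϖ_w) − χψ(ϖ_w))(ψ′(ϖ_w) − χψ(ϖ_{cw})) = 0`,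
  `χ = (ε/p)`, and the second factor cannot vanish by the root-of-unity exclusion (`M = 2`).
* `valueAtUniformizer_twist_eq_of_smul_eq` — **inert `w` (`c • w = w`): `ψ′(ϖ_w) = ψ(ϖ_w)`** (both are `−p`).
* `valueAtUniformizer_twist_div_eq` — the quotient form `ψ′(ϖ_w)/ψ(ϖ_w) ∈ {(ε/p), 1}` used by the avatar comparison (F2C).

References: [SilvermanATAEC1994] Ch. II Thm. 9.2, Thm. 10.5 (b) (Deuring); [SilvermanAEC2009] X.2, X.6, Exercise 10.16 (twisting of
`a_p`); [RubinSilverberg2002] §1; [NeukirchANT1999] Ch. VII §6 (6.13)–(6.14).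
-/

set_option autoImplicit false
-- D-0017 layout: summit = sub-problem, so `Summit.BirchSwinnertonDyer.BirchSwinnertonDyer.…` repeats a path component.
set_option linter.dupNamespace false

noncomputable section

open scoped Classical
open NumberField IsDedekindDomain Field WeierstrassCurve
open Literature.NumberTheory.GaloisRepresentations Literature.NumberTheory.EllipticCurves
open Literature.NumberTheory.EllipticCurves.Rank1Residual
open Summit.BirchSwinnertonDyer.BirchSwinnertonDyer.Theorems.PrintCf2.GoodTwistDictTypePin

namespace Summit.BirchSwinnertonDyer.BirchSwinnertonDyer.Theorems.PrintCf2.GoodTwistDictFrobenius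

variable {K : Type} [Field K] [NumberField K]

/-! ## §1 Root-of-unity exclusion for two characters -/

/-- **`ψ₂(ϖ_{c•w})^M ≠ ψ₁(ϖ_w)^M` (`M ≥ 1`)** for two Hecke characters of type `(1,0)` of an imaginary quadratic `K` with `d_K < −4`,
`h_K = 1`, `ψ₁` unramified at `w`, `ψ₂` at `c • w ≠ w`: both sides are `N`-th powers pinned to `e(α)`, `e(cα)` (F2A
`exists_pow_valueAtUniformizer_eq_pow_prod_embedding`), and `(cα/α)^L = 1` would force `c • w = w`.
[cite: NeukirchANT1999, Ch. VII §6 Cor. (6.14)] [cite: BhargavaVarma2016, Lemma 13] -/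
theorem valueAtUniformizer_pow_ne_pow_smul (hK : IsImaginaryQuadratic K) (hD : NumberField.discr K < -4)
    (hPID : IsPrincipalIdealRing (𝓞 K)) (c : K ≃ₐ[ℚ] K) {ψ₁ ψ₂ : HeckeCharacter K}
    (hψ₁ : ψ₁.HasInfinityType (fun _ ↦ 1) (fun _ ↦ 0)) (hψ₂ : ψ₂.HasInfinityType (fun _ ↦ 1) (fun _ ↦ 0))
    {w : HeightOneSpectrum (𝓞 K)} (h₁ : ψ₁.IsUnramifiedAt w) (h₂ : ψ₂.IsUnramifiedAt (c • w)) (hsplit : c • w ≠ w) {M : ℕ}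
    (hM : 0 < M) : ψ₂.valueAtUniformizer (c • w) ^ M ≠ ψ₁.valueAtUniformizer w ^ M := by
  haveI := hPID
  obtain ⟨α, hα'⟩ := (IsPrincipalIdealRing.principal w.asIdeal).principal
  have hα : Ideal.span {α} = w.asIdeal := by rw [hα']
  have hcα : Ideal.span {c • α} = (c • w).asIdeal := span_smul_eq_smul_asIdeal c hα
  have hα0 : α ≠ 0 := ne_zero_of_span_eq hα
  have hαK : (α : K) ≠ 0 := fun h ↦ hα0 (by exact_mod_cast h)
  obtain ⟨w₀, hw₀⟩ := exists_forall_infinitePlace_eq hK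
  obtain ⟨N₁, hN₁, e₁⟩ := exists_pow_valueAtUniformizer_eq_pow_prod_embedding hK hψ₁ h₁ hα
  obtain ⟨N₂, hN₂, e₂⟩ := exists_pow_valueAtUniformizer_eq_pow_prod_embedding hK hψ₂ h₂ hcα
  rw [prod_infinitePlace_eq hK hw₀] at e₁ e₂
  intro hM'
  have hcoe : ((c • α : 𝓞 K) : K) = c (α : K) := rfl
  have hL : w₀.embedding (c (α : K)) ^ (M * N₁ * N₂) = w₀.embedding (α : K) ^ (M * N₁ * N₂) := by
    rw [← hcoe]
    calc w₀.embedding ((c • α : 𝓞 K) : K) ^ (M * N₁ * N₂)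
        = (w₀.embedding ((c • α : 𝓞 K) : K) ^ N₂) ^ (M * N₁) := by rw [← pow_mul]; ring_nf
      _ = (ψ₂.valueAtUniformizer (c • w) ^ N₂) ^ (M * N₁) := by rw [e₂]
      _ = (ψ₂.valueAtUniformizer (c • w) ^ M) ^ (N₁ * N₂) := by rw [← pow_mul, ← pow_mul]; ring_nf
      _ = (ψ₁.valueAtUniformizer w ^ M) ^ (N₁ * N₂) := by rw [hM']
      _ = (ψ₁.valueAtUniformizer w ^ N₁) ^ (M * N₂) := by rw [← pow_mul, ← pow_mul]; ring_nf
      _ = (w₀.embedding (α : K) ^ N₁) ^ (M * N₂) := by rw [e₁]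
      _ = w₀.embedding (α : K) ^ (M * N₁ * N₂) := by rw [← pow_mul]; ring_nf
  have hLpos : 0 < M * N₁ * N₂ := Nat.mul_pos (Nat.mul_pos hM hN₁) hN₂
  have hx : (c (α : K) / (α : K)) ^ (M * N₁ * N₂) = 1 := by
    apply w₀.embedding.injective
    rw [map_pow, map_div₀, div_pow, hL, map_one, div_self]
    exact pow_ne_zero _ ((map_ne_zero w₀.embedding).mpr hαK)
  have hpm : c (α : K) = (α : K) ∨ c (α : K) = -(α : K) := by
    rcases eq_one_or_eq_neg_one_of_pow_eq_one hK.1 hD hLpos hx with h | h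
    · left; rwa [div_eq_one_iff_eq hαK] at h
    · right; rw [div_eq_iff hαK] at h; rw [h, neg_one_mul]
  have hspan : Ideal.span {c • α} = Ideal.span {α} := by
    rcases hpm with h | h
    · have : c • α = α := NumberField.RingOfIntegers.coe_injective (by
        change ((c • α : 𝓞 K) : K) = (α : K)
        rw [hcoe, h])
      rw [this]
    · have : c • α = -α := NumberField.RingOfIntegers.coe_injective (by
        change ((c • α : 𝓞 K) : K) = ((-α : 𝓞 K) : K)
        rw [hcoe, h]
        push_cast
        rfl)
      rw [this, Ideal.span_singleton_neg]
  exact hsplit (HeightOneSpectrum.ext (by rw [← hcα, hspan, hα]))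

/-! ## §2 The comparison at split and inert primes -/

section Frame

variable {d m ε : ℤ} {W W' : WeierstrassCurve ℚ} [W.IsElliptic] [W.IsGloballyMinimal] [W'.IsElliptic] [W'.IsGloballyMinimal]
  {C C'' : VariableChange ℚ} {v vbar : HeightOneSpectrum (𝓞 K)} {ψ ψ' : HeckeCharacter K}

/-- The Legendre symbol `(ε/p)` is `±1` for `p ∤ 2ε`, hence squares to `1` in `ℂ`. [folklore] -/
theorem legendreSym_cast_sq_eq_one {p : ℕ} [Fact p.Prime] (hpε : ¬ (p : ℤ) ∣ 2 * ε) :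
    ((legendreSym p ε : ℤ) : ℂ) ^ 2 = 1 := by
  have hne : (ε : ZMod p) ≠ 0 := by
    rw [Ne, ZMod.intCast_zmod_eq_zero_iff_dvd]
    exact fun h ↦ hpε (dvd_mul_of_dvd_right h 2)
  rcases legendreSym.eq_one_or_neg_one p hne with h | h <;> simp [h]

/-- **Split comparison: `ψ′(ϖ_w) = (ε/p)·ψ(ϖ_w)`.** Frame field `K` (imaginary quadratic, `v ≠ v̄` above `2`, `c ≠ 1`), `C • W = cm7^{(d)}`
(`d ≠ 0`), `W′` globally minimal with `C″ • W′ = cm7^{(m)}` (`m ≠ 0`) and `ℚ`-isomorphic to `W^{(ε)}` (`ε` square-free), `ψ`, `ψ′` of type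
`(1,0)` pinned to `W`, `W′`; `p ∤ 2ε` a prime of good reduction for `W` and `W′`, `w ∣ p` with `c • w ≠ w`. GRANTED Deuring's theorem.
[cite: SilvermanATAEC1994, Ch. II Thm. 10.5 (b)] [cite: SilvermanAEC2009, X.2 Exercise 10.16] [cite: RubinSilverberg2002, §1] -/
theorem valueAtUniformizer_twist_eq_of_smul_ne (hDe : Deuring_exists_heckeCharacter_of_maximalCM) (hK : IsImaginaryQuadratic K)
    (hd0 : d ≠ 0) (hCW : C • W = cm7.quadraticTwist (d : ℚ)) (hm0 : m ≠ 0) (hCW' : C'' • W' = cm7.quadraticTwist (m : ℚ))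
    (hε : Squarefree ε) (htw : ∃ C₁ : VariableChange ℚ, C₁ • W' = W.quadraticTwist (ε : ℚ))
    (hv : ((2 : ℕ) : 𝓞 K) ∈ v.asIdeal) (hvbar : ((2 : ℕ) : 𝓞 K) ∈ vbar.asIdeal) (hne : vbar ≠ v)
    (c : K ≃ₐ[ℚ] K) (hc : c ≠ 1)
    (hψ : ψ.HasInfinityType (fun _ ↦ 1) (fun _ ↦ 0)) (hψL : ∀ s : ℂ, 3 / 2 < s.re → heckeLFunction ψ s = W.LSeries s)
    (hψ' : ψ'.HasInfinityType (fun _ ↦ 1) (fun _ ↦ 0)) (hψ'L : ∀ s : ℂ, 3 / 2 < s.re → heckeLFunction ψ' s = W'.LSeries s)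
    {p : ℕ} [Fact p.Prime] (hpε : ¬ (p : ℤ) ∣ 2 * ε) (hpW : W.HasGoodReductionAtPrime p) (hpW' : W'.HasGoodReductionAtPrime p)
    {w : HeightOneSpectrum (𝓞 K)} (hpw : (p : 𝓞 K) ∈ w.asIdeal) (hsplit : c • w ≠ w) :
    ψ'.valueAtUniformizer w = (legendreSym p ε : ℂ) * ψ.valueAtUniformizer w := by
  -- Deuring (iv) for `W` and `W′`
  obtain ⟨-, hiv⟩ := FramePinning.frame_eq_deuring hDe hd0 hCW hK hv hvbar hne c hc hψ hψL
  obtain ⟨-, hiv'⟩ := FramePinning.frame_eq_deuring hDe hm0 hCW' hK hv hvbar hne c hc hψ' hψ'L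
  obtain ⟨hw, hsp, -⟩ := hiv p hpW w hpw
  obtain ⟨hw', hsp', -⟩ := hiv' p hpW' w hpw
  obtain ⟨hsum, hprod⟩ := hsp hsplit
  obtain ⟨hsum', hprod'⟩ := hsp' hsplit
  -- `ψ` is unramified at `c • w` as well (same `p`)
  have hfix : c • (p : 𝓞 K) = (p : 𝓞 K) := map_natCast (MulSemiringAction.toRingHom _ (𝓞 K) c) p
  have hpcw : (p : 𝓞 K) ∈ (c • w).asIdeal := by
    rw [← hfix]
    exact (Literature.NumberTheory.Automorphic.HeightOneSpectrum.smul_mem_smul_asIdeal_iff c w _).mpr hpw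
  obtain ⟨hcw, -, -⟩ := hiv p hpW (c • w) hpcw
  -- twisting of `a_p`
  have hΔ : ¬ (p : ℤ) ∣ W.minimalDiscriminantInt := fun hdvd ↦
    WeierstrassCurve.not_hasGoodReductionAtPrime_of_dvd_minimalDiscriminantInt W p hdvd hpW
  have htr : W'.frobeniusTrace p = legendreSym p ε * W.frobeniusTrace p :=
    frobeniusTrace_quadraticTwist_holds W W' ε hε htw p hpε hΔ
  have htrC : (W'.frobeniusTrace p : ℂ) = (legendreSym p ε : ℂ) * (W.frobeniusTrace p : ℂ) := by exact_mod_cast htr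
  -- the quadratic identity
  set χ : ℂ := (legendreSym p ε : ℂ) with hχdef
  have hχ2 : χ ^ 2 = 1 := legendreSym_cast_sq_eq_one hpε
  set z := ψ.valueAtUniformizer w
  set zc := ψ.valueAtUniformizer (c • w)
  set z' := ψ'.valueAtUniformizer w
  set zc' := ψ'.valueAtUniformizer (c • w)
  have hquad : (z' - χ * z) * (z' - χ * zc) = 0 := by
    rw [htrC] at hsum'
    linear_combination (-(χ * z')) * hsum + χ ^ 2 * hprod + z' * hsum' - hprod' + (p : ℂ) * hχ2
  rcases mul_eq_zero.mp hquad with h | h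
  · exact sub_eq_zero.mp h
  · -- `z' = χ zc` contradicts the root-of-unity exclusion (`z'² = zc²`)
    exfalso
    have hPID := FramePinning.isPrincipalIdealRing_of_frame hd0 hCW hK hv hvbar hne hψL
    have hD : NumberField.discr K < -4 := by rw [FramePinning.discr_eq_neg_seven_of_frame hd0 hCW hK hv hvbar hne hψL]; norm_num
    refine valueAtUniformizer_pow_ne_pow_smul hK hD hPID c hψ' hψ hw' hcw hsplit two_pos ?_
    have hz' : z' = χ * zc := sub_eq_zero.mp h
    change zc ^ 2 = z' ^ 2
    rw [hz', mul_pow, hχ2, one_mul]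

/-- **Inert comparison: `ψ′(ϖ_w) = ψ(ϖ_w)`** (`c • w = w`; both values are `−p`). Same frame as `valueAtUniformizer_twist_eq_of_smul_ne`.
[cite: SilvermanATAEC1994, Ch. II Thm. 10.5 (b)] -/
theorem valueAtUniformizer_twist_eq_of_smul_eq (hDe : Deuring_exists_heckeCharacter_of_maximalCM) (hK : IsImaginaryQuadratic K)
    (hd0 : d ≠ 0) (hCW : C • W = cm7.quadraticTwist (d : ℚ)) (hm0 : m ≠ 0) (hCW' : C'' • W' = cm7.quadraticTwist (m : ℚ))
    (hv : ((2 : ℕ) : 𝓞 K) ∈ v.asIdeal) (hvbar : ((2 : ℕ) : 𝓞 K) ∈ vbar.asIdeal) (hne : vbar ≠ v)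
    (c : K ≃ₐ[ℚ] K) (hc : c ≠ 1)
    (hψ : ψ.HasInfinityType (fun _ ↦ 1) (fun _ ↦ 0)) (hψL : ∀ s : ℂ, 3 / 2 < s.re → heckeLFunction ψ s = W.LSeries s)
    (hψ' : ψ'.HasInfinityType (fun _ ↦ 1) (fun _ ↦ 0)) (hψ'L : ∀ s : ℂ, 3 / 2 < s.re → heckeLFunction ψ' s = W'.LSeries s)
    {p : ℕ} [Fact p.Prime] (hpW : W.HasGoodReductionAtPrime p) (hpW' : W'.HasGoodReductionAtPrime p)
    {w : HeightOneSpectrum (𝓞 K)} (hpw : (p : 𝓞 K) ∈ w.asIdeal) (hinert : c • w = w) :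
    ψ'.valueAtUniformizer w = ψ.valueAtUniformizer w := by
  obtain ⟨-, hiv⟩ := FramePinning.frame_eq_deuring hDe hd0 hCW hK hv hvbar hne c hc hψ hψL
  obtain ⟨-, hiv'⟩ := FramePinning.frame_eq_deuring hDe hm0 hCW' hK hv hvbar hne c hc hψ' hψ'L
  obtain ⟨-, -, hin⟩ := hiv p hpW w hpw
  obtain ⟨-, -, hin'⟩ := hiv' p hpW' w hpw
  rw [(hin hinert).2, (hin' hinert).2]

/-- **The quotient `ψ′(ϖ_w)/ψ(ϖ_w)`**: `(ε/p)` if `c • w ≠ w`, `1` if `c • w = w` (and `ψ(ϖ_w) ≠ 0`). Same frame; used by the avatar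
comparison (F2C). [cite: SilvermanATAEC1994, Ch. II Thm. 10.5 (b)] [cite: RubinSilverberg2002, §1] -/
theorem valueAtUniformizer_mul_inv_eq (hDe : Deuring_exists_heckeCharacter_of_maximalCM) (hK : IsImaginaryQuadratic K)
    (hd0 : d ≠ 0) (hCW : C • W = cm7.quadraticTwist (d : ℚ)) (hm0 : m ≠ 0) (hCW' : C'' • W' = cm7.quadraticTwist (m : ℚ))
    (hε : Squarefree ε) (htw : ∃ C₁ : VariableChange ℚ, C₁ • W' = W.quadraticTwist (ε : ℚ))
    (hv : ((2 : ℕ) : 𝓞 K) ∈ v.asIdeal) (hvbar : ((2 : ℕ) : 𝓞 K) ∈ vbar.asIdeal) (hne : vbar ≠ v)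
    (c : K ≃ₐ[ℚ] K) (hc : c ≠ 1)
    (hψ : ψ.HasInfinityType (fun _ ↦ 1) (fun _ ↦ 0)) (hψL : ∀ s : ℂ, 3 / 2 < s.re → heckeLFunction ψ s = W.LSeries s)
    (hψ' : ψ'.HasInfinityType (fun _ ↦ 1) (fun _ ↦ 0)) (hψ'L : ∀ s : ℂ, 3 / 2 < s.re → heckeLFunction ψ' s = W'.LSeries s)
    {p : ℕ} [Fact p.Prime] (hpε : ¬ (p : ℤ) ∣ 2 * ε) (hpW : W.HasGoodReductionAtPrime p) (hpW' : W'.HasGoodReductionAtPrime p)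
    {w : HeightOneSpectrum (𝓞 K)} (hpw : (p : 𝓞 K) ∈ w.asIdeal) :
    (ψ' * ψ⁻¹).valueAtUniformizer w = if c • w = w then 1 else (legendreSym p ε : ℂ) := by
  -- `ψ(ϖ_w) ≠ 0`: `ψ(ϖ_w)ψ(ϖ_{cw}) = p` (split) or `ψ(ϖ_w) = −p` (inert)
  obtain ⟨-, hiv⟩ := FramePinning.frame_eq_deuring hDe hd0 hCW hK hv hvbar hne c hc hψ hψL
  obtain ⟨-, hsp, hin⟩ := hiv p hpW w hpw
  have hp0 : (p : ℂ) ≠ 0 := by exact_mod_cast (Fact.out : p.Prime).ne_zero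
  have hz0 : ψ.valueAtUniformizer w ≠ 0 := by
    by_cases h : c • w = w
    · rw [(hin h).2]; exact neg_ne_zero.mpr hp0
    · intro h0
      have := (hsp h).2
      rw [h0, zero_mul] at this
      exact hp0 this.symm
  rw [HeckeCharacter.valueAtUniformizer_mul', HeckeCharacter.valueAtUniformizer_inv']
  split_ifs with h
  · rw [valueAtUniformizer_twist_eq_of_smul_eq hDe hK hd0 hCW hm0 hCW' hv hvbar hne c hc hψ hψL hψ' hψ'L hpW hpW' hpw h,
      mul_inv_cancel₀ hz0]
  · rw [valueAtUniformizer_twist_eq_of_smul_ne hDe hK hd0 hCW hm0 hCW' hε htw hv hvbar hne c hc hψ hψL hψ' hψ'L hpε hpW hpW' hpw h,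
      mul_assoc, mul_inv_cancel₀ hz0, mul_one]

end Frame

end Summit.BirchSwinnertonDyer.BirchSwinnertonDyer.Theorems.PrintCf2.GoodTwistDictFrobenius

end
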